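import Summits.RiemannHypothesis.RiemannHypothesis.Theorems.PfPersistenceCoefficientRigidity
import Literature.NumberTheory.LFunctions.WeilLineSupSamplingPrelim
import Literature.NumberTheory.LFunctions.SelbergArgOmegaOffLine
import Literature.NumberTheory.LFunctions.WeilBochnerExtension
import Summits.RiemannHypothesis.RiemannHypothesis.Theorems.SignConeSignConeOscillatoryStubFakeZeroMeasureOfRH
import HarnessLib

/-!
# Coefficient rigidity of window positivity, III-a: wave packets off the zero ordinates
(pub-rhpf cand-7, gen 9; mechanism/rigidity campaign; no RH claims)

Toolkit for `PfPersistenceCoefficientRigidityZeroWidth` (the hairline `λ ↦ W + λ(δ_{x₀} + δ_{-x₀})`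
has width ZERO).  ALL STATEMENTS ARE PROVED (no `sorry`, no new axioms; RH appears only as an
explicit hypothesis of `re_zeroForm_wavePacket_le`); no sentence of this file is DATA.

WAVE PACKETS `g_{R,t₀}(t) = ψ(t/R) e^{-i t₀ t}` (`ψ` a plateau bump, `R → ∞`):
* `weilMellin_wavePacket` — modulation shifts, dilation rescales:
  `ĝ_{R,t₀}(s) = R ψ̂(1/2 + R(s - i t₀ - 1/2))`; on the critical line
  `|ĝ_{R,t₀}(1/2+iγ)| ≤ R C_ψ/(1 + R²(γ - t₀)²)` (`norm_weilMellin_wavePacket_le`, from the tree's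
  second-order decay `norm_weilMellin_le`).
* `re_zeroForm_wavePacket_le` — (RH as hypothesis) if the carrier `t₀` keeps distance `d > 0` from
  every zero ordinate then the zero-side form is small:
  `Re Q(g_{R,t₀}) ≤ (C_ψ L)² R⁻² ∑_ρ m(ρ)/(1+γ²)²`, `L = (1 + 2t₀²)(2 + d⁻²)` (zeros on the line via
  the tree's `SignConeOscillatory.re_eq_half_of_riemannHypothesis`).
* `exists_far_from_ordinates` — every interval `[a, b]`, `a < b`, contains a carrier at positive
  distance from all ordinates (local finiteness, `weilZeroFinset`).
* `re_weilConv_wavePacket`, `plateau_overlap_ge` — the site term: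
  `Re (g ⋆ g̃)(x₀) = cos(t₀ x₀) ∫ ψ(u/R)ψ((u-x₀)/R) du` with the overlap integral `≥ R - x₀`.
* `exists_Icc_mul_cos_le` — for `x₀ > 0`, `λ ≠ 0` an interval of carriers with
  `λ cos(t x₀) ≤ -|λ|/2`.

References: E. Bombieri, *Remarks on Weil's quadratic functional in the theory of prime numbers
I*, Rend. Lincei (9) 11 (2000) 183–233, §3 (the zero-side form `Q`); A. Weil (1952).
-/

set_option linter.dupNamespace false

noncomputable section

open Complex Filter Set MeasureTheory
open scoped Real Topology ComplexConjugate

namespace Summit.RiemannHypothesis.RiemannHypothesis.Theorems.PfPersistenceCoefficientRigidity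

open Literature.NumberTheory.LFunctions
open Literature.NumberTheory.LFunctions.WeilConverse

/-! ## §10 Wave packets -/

/-- The plateau bump `ψ`: smooth, `ψ = 1` on `[-1/2, 1/2]`, `0 ≤ ψ ≤ 1`, `supp ψ ⊆ [-1, 1]`
(Mathlib's `ContDiffBump` with `rIn = 1/2`, `rOut = 1`). [folklore] -/
def plateau : ContDiffBump (0 : ℝ) := ⟨1 / 2, 1, by norm_num, by norm_num⟩

/-- `ψ` as a complex-valued function. [folklore] -/
def plateauC (t : ℝ) : ℂ := ((plateau t : ℝ) : ℂ)

/-- The WAVE PACKET `g_{R,t₀}(t) = ψ(t/R) e^{-i t₀ t}`: a plateau of length `≍ R` carrying the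
frequency `t₀`. [this work] -/
def wavePacket (R t₀ : ℝ) (t : ℝ) : ℂ :=
  plateauC (t / R) * cexp ((((-t₀) * t : ℝ) : ℂ) * I)

/-- `ψ` is a test function. [folklore] -/
theorem isWeilTest_plateauC : IsWeilTest plateauC := WeilBochner.isWeilTest_bump plateau

/-- Dilates of `ψ` are test functions. [folklore] -/
theorem isWeilTest_plateauC_dilate {R : ℝ} (hR : 0 < R) :
    IsWeilTest fun t : ℝ ↦ plateauC (t / R) := by
  refine ⟨isWeilTest_plateauC.1.comp (contDiff_id.div_const R), ?_⟩
  have e : (fun t : ℝ ↦ plateauC (t / R)) =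
      plateauC ∘ (Homeomorph.mulRight₀ R⁻¹ (inv_ne_zero hR.ne')) := by
    ext t
    simp [div_eq_mul_inv]
  rw [e]
  exact isWeilTest_plateauC.2.comp_homeomorph _

/-- Wave packets are test functions. [folklore] -/
theorem isWeilTest_wavePacket {R : ℝ} (hR : 0 < R) (t₀ : ℝ) : IsWeilTest (wavePacket R t₀) :=
  isWeilTest_mul_cexp_ofReal_mul_I (isWeilTest_plateauC_dilate hR) (-t₀)

/-- **Transform of a wave packet** (modulation shifts, dilation rescales):
`ĝ_{R,t₀}(s) = R ψ̂(1/2 + R(s - i t₀ - 1/2))`. [folklore] -/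
theorem weilMellin_wavePacket {R : ℝ} (hR : 0 < R) (t₀ : ℝ) (s : ℂ) :
    weilMellin (wavePacket R t₀) s =
      R * weilMellin plateauC (1 / 2 + R * (s + ((-t₀ : ℝ) : ℂ) * I - 1 / 2)) := by
  show weilMellin (fun t ↦ (fun t ↦ plateauC (t / R)) t * cexp ((((-t₀) * t : ℝ) : ℂ) * I)) s = _
  rw [weilMellin_mul_cexp_ofReal_mul_I, SelbergOmega.weilMellin_dilate _ hR]

/-- On the critical line the transform of a wave packet is a rescaled, recentred `ψ̂`:
`|ĝ_{R,t₀}(1/2 + iγ)| ≤ R C_ψ/(1 + R²(γ - t₀)²)` (`norm_weilMellin_le`). [folklore] -/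
theorem norm_weilMellin_wavePacket_le {R : ℝ} (hR : 0 < R) (t₀ : ℝ) {ρ : ℂ}
    (hρ : ρ.re = 1 / 2) :
    ‖weilMellin (wavePacket R t₀) ρ‖ ≤
      R * weilDecayConst plateauC / (1 + (R * (ρ.im - t₀)) ^ 2) := by
  rw [weilMellin_wavePacket hR]
  set s' : ℂ := 1 / 2 + R * (ρ + ((-t₀ : ℝ) : ℂ) * I - 1 / 2) with hs'
  have hre : s'.re = 1 / 2 := by simp [hs', hρ]
  have him : s'.im = R * (ρ.im - t₀) := by
    simp only [hs', add_im, sub_im, mul_im, ofReal_re, ofReal_im, I_re, I_im, div_ofNat_im,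
      one_im, zero_div]
    ring
  have h := norm_weilMellin_le isWeilTest_plateauC (s := s') (by rw [hre]; norm_num)
    (by rw [hre]; norm_num)
  rw [him] at h
  rw [norm_mul, Complex.norm_real, Real.norm_of_nonneg hR.le, mul_div_assoc]
  exact mul_le_mul_of_nonneg_left h hR.le

/-- On the critical line `|P_g(ρ)| = |ĝ(ρ)|²` (`1 - ρ̄ = ρ`). [cite: Bombieri2000Weil, §3] -/
theorem norm_pairCoeff_eq_sq (g : ℝ → ℂ) {ρ : ℂ} (hρ : ρ.re = 1 / 2) :
    ‖pairCoeff g ρ‖ = ‖weilMellin g ρ‖ ^ 2 := by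
  have h1 : 1 - conj ρ = ρ := by
    apply Complex.ext
    · simp only [sub_re, one_re, conj_re, hρ]; norm_num
    · simp
  rw [pairCoeff, h1, norm_mul, Complex.norm_conj, sq]

/-- **Termwise bound.** If the carrier keeps distance `d` from the ordinate `γ` of a critical zero
`ρ`, then `|P_{g_{R,t₀}}(ρ)| ≤ (C_ψ L)² R⁻² /(1 + γ²)²` with `L = (1 + 2t₀²)(2 + d⁻²)`. [this work] -/
theorem norm_pairCoeff_wavePacket_le {R t₀ d : ℝ} (hR : 0 < R) (hd : 0 < d) {ρ : ℂ}
    (hρ : ρ.re = 1 / 2) (hsep : d ≤ |ρ.im - t₀|) :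
    ‖pairCoeff (wavePacket R t₀) ρ‖ ≤
      (weilDecayConst plateauC * ((1 + 2 * t₀ ^ 2) * (2 + 1 / d ^ 2))) ^ 2 / R ^ 2 /
        (1 + ρ.im ^ 2) ^ 2 := by
  set C := weilDecayConst plateauC with hCdef
  set L := (1 + 2 * t₀ ^ 2) * (2 + 1 / d ^ 2) with hLdef
  have hC : 0 ≤ C := weilDecayConst_nonneg _
  have hη0 : 0 < (ρ.im - t₀) ^ 2 := by
    have : 0 < |ρ.im - t₀| := hd.trans_le hsep
    nlinarith [sq_abs (ρ.im - t₀)]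
  have hγ : 1 + ρ.im ^ 2 ≤ L * (ρ.im - t₀) ^ 2 := by
    have h1 : d ^ 2 ≤ (ρ.im - t₀) ^ 2 := by nlinarith [sq_abs (ρ.im - t₀), abs_nonneg (ρ.im - t₀)]
    have h2 : 1 ≤ (ρ.im - t₀) ^ 2 / d ^ 2 := by rw [le_div_iff₀ (by positivity)]; linarith
    have h3 : ρ.im ^ 2 ≤ 2 * (ρ.im - t₀) ^ 2 + 2 * t₀ ^ 2 := by
      nlinarith [sq_nonneg (ρ.im - 2 * t₀)]
    have h4 : (1 + 2 * t₀ ^ 2) * 1 ≤ (1 + 2 * t₀ ^ 2) * ((ρ.im - t₀) ^ 2 / d ^ 2) :=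
      mul_le_mul_of_nonneg_left h2 (by positivity)
    have h5 : 2 * (ρ.im - t₀) ^ 2 ≤ 2 * (1 + 2 * t₀ ^ 2) * (ρ.im - t₀) ^ 2 := by
      nlinarith [sq_nonneg t₀, hη0.le]
    have hL : L * (ρ.im - t₀) ^ 2 =
        2 * (1 + 2 * t₀ ^ 2) * (ρ.im - t₀) ^ 2 + (1 + 2 * t₀ ^ 2) * ((ρ.im - t₀) ^ 2 / d ^ 2) := by
      rw [hLdef]; ring
    rw [hL]
    linarith
  have hA : ‖weilMellin (wavePacket R t₀) ρ‖ ≤ C * L / (R * (1 + ρ.im ^ 2)) := by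
    have h1 := norm_weilMellin_wavePacket_le hR t₀ hρ
    have h2 : R * C / (1 + (R * (ρ.im - t₀)) ^ 2) ≤ R * C / (R ^ 2 * (ρ.im - t₀) ^ 2) :=
      div_le_div_of_nonneg_left (by positivity) (by positivity) (by nlinarith)
    have h3 : R * C / (R ^ 2 * (ρ.im - t₀) ^ 2) = C / (R * (ρ.im - t₀) ^ 2) := by
      field_simp
    have h4 : C / (R * (ρ.im - t₀) ^ 2) ≤ C * L / (R * (1 + ρ.im ^ 2)) := by
      rw [div_le_div_iff₀ (by positivity) (by positivity)]
      have := mul_le_mul_of_nonneg_left hγ (by positivity : 0 ≤ C * R)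
      nlinarith [this]
    exact h1.trans (h2.trans (h3.le.trans h4))
  rw [norm_pairCoeff_eq_sq _ hρ]
  calc ‖weilMellin (wavePacket R t₀) ρ‖ ^ 2 ≤ (C * L / (R * (1 + ρ.im ^ 2))) ^ 2 :=
        pow_le_pow_left₀ (norm_nonneg _) hA 2
    _ = (C * L) ^ 2 / R ^ 2 / (1 + ρ.im ^ 2) ^ 2 := by
        have h1 : (R : ℝ) ≠ 0 := hR.ne'
        have h2 : (1 + ρ.im ^ 2) ≠ 0 := by positivity
        field_simp

/-! ## §11 The zero side of a wave packet off the ordinates is `O(R⁻²)` (RH branch) -/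

/-- **Zero side of a wave packet** (RH): if every zero ordinate is at distance `≥ d > 0` from the
carrier `t₀`, then `Re Q(g_{R,t₀}) ≤ (C_ψ L)² R⁻² · ∑_ρ m(ρ)/(1+γ²)²`. [this work] -/
theorem re_zeroForm_wavePacket_le (hRH : RiemannHypothesis) {R t₀ d : ℝ} (hR : 0 < R)
    (hd : 0 < d) (hsep : ∀ ρ ∈ ZetaZeros.riemannZetaNontrivialZeros, d ≤ |ρ.im - t₀|) :
    (zeroForm (wavePacket R t₀)).re ≤
      (weilDecayConst plateauC * ((1 + 2 * t₀ ^ 2) * (2 + 1 / d ^ 2))) ^ 2 / R ^ 2 *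
        ∑' ρ : ZetaZeros.riemannZetaNontrivialZeros, weilZeroWeight (ρ : ℂ) := by
  set K := (weilDecayConst plateauC * ((1 + 2 * t₀ ^ 2) * (2 + 1 / d ^ 2))) ^ 2 / R ^ 2
    with hKdef
  have hg := isWeilTest_wavePacket hR t₀
  have hterm : ∀ ρ : ZetaZeros.riemannZetaNontrivialZeros,
      ‖(riemannZetaZeroOrder (ρ : ℂ) : ℂ) * pairCoeff (wavePacket R t₀) ρ‖ ≤
        K * weilZeroWeight (ρ : ℂ) := by
    intro ρ
    have hm : (0 : ℝ) ≤ riemannZetaZeroOrder (ρ : ℂ) := by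
      exact_mod_cast riemannZetaZeroOrder_nonneg (ZetaZeros.riemannZetaNontrivialZeros.ne_one ρ.2)
    have hP := norm_pairCoeff_wavePacket_le hR hd
      (SignConeOscillatory.re_eq_half_of_riemannHypothesis hRH ρ)
      (hsep ρ ρ.2)
    rw [norm_mul, Complex.norm_intCast, abs_of_nonneg hm, weilZeroWeight]
    calc (riemannZetaZeroOrder (ρ : ℂ) : ℝ) * ‖pairCoeff (wavePacket R t₀) ρ‖
        ≤ (riemannZetaZeroOrder (ρ : ℂ) : ℝ) * (K / (1 + (ρ : ℂ).im ^ 2) ^ 2) :=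
          mul_le_mul_of_nonneg_left hP hm
      _ = K * ((riemannZetaZeroOrder (ρ : ℂ) : ℝ) / (1 + (ρ : ℂ).im ^ 2) ^ 2) := by ring
  have hsum : Summable fun ρ : ZetaZeros.riemannZetaNontrivialZeros ↦ K * weilZeroWeight (ρ : ℂ) :=
    weilZeroSummable.mul_left K
  calc (zeroForm (wavePacket R t₀)).re ≤ ‖zeroForm (wavePacket R t₀)‖ := Complex.re_le_norm _
    _ ≤ ∑' ρ : ZetaZeros.riemannZetaNontrivialZeros,
          ‖(riemannZetaZeroOrder (ρ : ℂ) : ℂ) * pairCoeff (wavePacket R t₀) ρ‖ :=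
        norm_tsum_le_tsum_norm (summable_norm_pairCoeff hg)
    _ ≤ ∑' ρ : ZetaZeros.riemannZetaNontrivialZeros, K * weilZeroWeight (ρ : ℂ) :=
        (summable_norm_pairCoeff hg).tsum_le_tsum hterm hsum
    _ = K * ∑' ρ : ZetaZeros.riemannZetaNontrivialZeros, weilZeroWeight (ρ : ℂ) := tsum_mul_left

/-- **Carriers off the ordinates exist in every interval**: the zeros with `|Im ρ| ≤ T` are finitely
many (`weilZeroFinset`), so `[a, b]` contains a point at positive distance from every ordinate.
[folklore] -/
theorem exists_far_from_ordinates {a b : ℝ} (hab : a < b) :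
    ∃ t₀ ∈ Icc a b, ∃ d : ℝ, 0 < d ∧
      ∀ ρ ∈ ZetaZeros.riemannZetaNontrivialZeros, d ≤ |ρ.im - t₀| := by
  set T := max |a| |b| + 1 with hT
  set B : Finset ℝ :=
    (weilZeroFinset T).image (fun ρ : ZetaZeros.riemannZetaNontrivialZeros ↦ (ρ.1).im) with hB
  obtain ⟨t₀, ht₀, hnot⟩ := (Set.Icc_infinite hab).exists_notMem_finset B
  have ht₀T : |t₀| + 1 ≤ T := by
    have : |t₀| ≤ max |a| |b| := abs_le_max_abs_abs ht₀.1 ht₀.2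
    rw [hT]; linarith
  obtain ⟨d, hd, hd1, hdB⟩ : ∃ d : ℝ, 0 < d ∧ d ≤ 1 ∧ ∀ γ ∈ B, d ≤ |γ - t₀| := by
    rcases B.eq_empty_or_nonempty with hBe | hBn
    · exact ⟨1, one_pos, le_rfl, by simp [hBe]⟩
    · obtain ⟨γ₀, hγ₀, hmin⟩ := B.exists_min_image (fun γ ↦ |γ - t₀|) hBn
      have hne : γ₀ ≠ t₀ := by
        rintro rfl
        exact hnot hγ₀
      have hpos : 0 < |γ₀ - t₀| := abs_pos.2 (sub_ne_zero.2 hne)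
      exact ⟨min 1 |γ₀ - t₀|, lt_min one_pos hpos, min_le_left _ _,
        fun γ hγ ↦ (min_le_right _ _).trans (hmin γ hγ)⟩
  refine ⟨t₀, ht₀, d, hd, fun ρ hρ ↦ ?_⟩
  by_cases hle : |ρ.im| ≤ T
  · have hmem : ρ.im ∈ B := by
      rw [hB, Finset.mem_image]
      exact ⟨⟨ρ, hρ⟩, mem_weilZeroFinset.2 hle, rfl⟩
    exact hdB _ hmem
  · push Not at hle
    have := abs_sub_abs_le_abs_sub ρ.im t₀
    linarith

/-! ## §12 The site term of a wave packet -/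

/-- **Autocorrelation of a wave packet at the site**:
`(g ⋆ g̃)(x₀) = e^{-i t₀ x₀} ∫ ψ(u/R) ψ((u - x₀)/R) du`. [this work] -/
theorem weilConv_wavePacket (R t₀ x₀ : ℝ) :
    weilConv (wavePacket R t₀) (weilReflect (wavePacket R t₀)) x₀ =
      cexp ((((-t₀) * x₀ : ℝ) : ℂ) * I) *
        ((∫ u, plateau (u / R) * plateau ((u - x₀) / R) : ℝ) : ℂ) := by
  rw [weilConv_apply]
  have e : ∀ u : ℝ, wavePacket R t₀ u * weilReflect (wavePacket R t₀) (x₀ - u) =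
      cexp ((((-t₀) * x₀ : ℝ) : ℂ) * I) *
        ((plateau (u / R) * plateau ((u - x₀) / R) : ℝ) : ℂ) := by
    intro u
    have hab : (((-t₀) * u : ℝ) : ℂ) * I + (((-t₀) * (u - x₀) : ℝ) : ℂ) * -I =
        (((-t₀) * x₀ : ℝ) : ℂ) * I := by
      push_cast
      ring
    simp only [wavePacket, plateauC, weilReflect, neg_sub, map_mul, Complex.conj_ofReal,
      ← Complex.exp_conj, Complex.conj_I]
    rw [← hab, Complex.exp_add]
    push_cast
    ring
  simp_rw [e]
  rw [integral_const_mul, integral_complex_ofReal]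

/-- Its real part: `Re (g ⋆ g̃)(x₀) = cos(t₀ x₀) ∫ ψ(u/R) ψ((u - x₀)/R) du`. [this work] -/
theorem re_weilConv_wavePacket (R t₀ x₀ : ℝ) :
    (weilConv (wavePacket R t₀) (weilReflect (wavePacket R t₀)) x₀).re =
      Real.cos (t₀ * x₀) * ∫ u, plateau (u / R) * plateau ((u - x₀) / R) := by
  rw [weilConv_wavePacket, mul_comm, Complex.re_ofReal_mul, Complex.exp_ofReal_mul_I_re, neg_mul,
    Real.cos_neg, mul_comm]

/-- **The overlap integral is long**: `∫ ψ(u/R) ψ((u - x₀)/R) du ≥ R - x₀` for `0 ≤ x₀`,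
`2x₀ ≤ R` (both factors equal `1` on `[x₀ - R/2, R/2]`, and the integrand is `≥ 0`). [this work] -/
theorem plateau_overlap_ge {R x₀ : ℝ} (hx0 : 0 ≤ x₀) (hRx : 2 * x₀ ≤ R) (hR : 0 < R) :
    R - x₀ ≤ ∫ u, plateau (u / R) * plateau ((u - x₀) / R) := by
  set f : ℝ → ℝ := fun u ↦ plateau (u / R) * plateau ((u - x₀) / R) with hf
  have hrIn : plateau.rIn = 1 / 2 := rfl
  have hcont : Continuous f :=
    (plateau.continuous.comp (continuous_id.div_const R)).mul
      (plateau.continuous.comp ((continuous_id.sub continuous_const).div_const R))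
  have hsupp : HasCompactSupport f := by
    refine HasCompactSupport.mul_right ?_
    have e : (fun u : ℝ ↦ (plateau : ℝ → ℝ) (u / R)) =
        (plateau : ℝ → ℝ) ∘ (Homeomorph.mulRight₀ R⁻¹ (inv_ne_zero hR.ne')) := by
      ext u
      simp [div_eq_mul_inv]
    rw [e]
    exact plateau.hasCompactSupport.comp_homeomorph _
  have hfi : Integrable f := hcont.integrable_of_hasCompactSupport hsupp
  have hf0 : 0 ≤ᵐ[volume] f :=
    Eventually.of_forall fun u ↦ mul_nonneg plateau.nonneg plateau.nonneg
  have hS : EqOn (fun _ ↦ (1 : ℝ)) f (Icc (x₀ - R / 2) (R / 2)) := by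
    intro u hu
    rw [mem_Icc] at hu
    have h1 : plateau (u / R) = 1 := plateau.one_of_mem_closedBall (by
      rw [Metric.mem_closedBall, dist_zero_right, Real.norm_eq_abs, hrIn, abs_le]
      constructor
      · rw [le_div_iff₀ hR]; linarith
      · rw [div_le_iff₀ hR]; linarith)
    have h2 : plateau ((u - x₀) / R) = 1 := plateau.one_of_mem_closedBall (by
      rw [Metric.mem_closedBall, dist_zero_right, Real.norm_eq_abs, hrIn, abs_le]
      constructor
      · rw [le_div_iff₀ hR]; linarith
      · rw [div_le_iff₀ hR]; linarith)
    simp only [hf, h1, h2, mul_one]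
  calc R - x₀ = ∫ _ in Icc (x₀ - R / 2) (R / 2), (1 : ℝ) := by
        rw [setIntegral_const, Real.volume_real_Icc_of_le (by linarith), smul_eq_mul, mul_one]
        ring
    _ = ∫ u in Icc (x₀ - R / 2) (R / 2), f u := setIntegral_congr_fun measurableSet_Icc hS
    _ ≤ ∫ u, f u := setIntegral_le_integral hfi hf0

/-- **A carrier of the right sign exists in an interval**: for `x₀ > 0`, `λ ≠ 0` there are `a < b`
with `λ cos(t x₀) ≤ -|λ|/2` on `[a, b]`. [folklore] -/
theorem exists_Icc_mul_cos_le {x₀ lam : ℝ} (hx0 : 0 < x₀) (hlam : lam ≠ 0) :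
    ∃ a b : ℝ, a < b ∧ ∀ t ∈ Icc a b, lam * Real.cos (t * x₀) ≤ -(|lam| / 2) := by
  rcases hlam.lt_or_gt with hneg | hpos
  · refine ⟨-(π / 3) / x₀, (π / 3) / x₀, ?_, fun t ht ↦ ?_⟩
    · have : 0 < π / 3 / x₀ := by positivity
      have : -(π / 3) / x₀ = -(π / 3 / x₀) := by ring
      linarith
    rw [mem_Icc] at ht
    have h1 : -(π / 3) ≤ t * x₀ := (div_le_iff₀ hx0).1 ht.1
    have h2 : t * x₀ ≤ π / 3 := (le_div_iff₀ hx0).1 ht.2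
    have hθ : |t * x₀| ≤ π / 3 := abs_le.2 ⟨h1, h2⟩
    have hcos : 1 / 2 ≤ Real.cos (t * x₀) := by
      rw [← Real.cos_pi_div_three, ← Real.cos_abs (t * x₀)]
      exact Real.cos_le_cos_of_nonneg_of_le_pi (abs_nonneg _) (by linarith [Real.pi_pos]) hθ
    rw [abs_of_neg hneg]
    nlinarith
  · refine ⟨(2 * π / 3) / x₀, (4 * π / 3) / x₀, ?_, fun t ht ↦ ?_⟩
    · rw [div_lt_div_iff_of_pos_right hx0]
      linarith [Real.pi_pos]
    rw [mem_Icc] at ht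
    have h1 : 2 * π / 3 ≤ t * x₀ := (div_le_iff₀ hx0).1 ht.1
    have h2 : t * x₀ ≤ 4 * π / 3 := (le_div_iff₀ hx0).1 ht.2
    have hθ : |t * x₀ - π| ≤ π / 3 := abs_le.2 ⟨by linarith, by linarith⟩
    have hcos : Real.cos (t * x₀) ≤ -(1 / 2) := by
      have : 1 / 2 ≤ Real.cos (t * x₀ - π) := by
        rw [← Real.cos_pi_div_three, ← Real.cos_abs (t * x₀ - π)]
        exact Real.cos_le_cos_of_nonneg_of_le_pi (abs_nonneg _) (by linarith [Real.pi_pos]) hθ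
      rw [Real.cos_sub_pi] at this
      linarith
    rw [abs_of_pos hpos]
    nlinarith

end Summit.RiemannHypothesis.RiemannHypothesis.Theorems.PfPersistenceCoefficientRigidity

end
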